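import Summits.QuantumFields.YangMills.Theorems.FluctuationComparisonRegPrIntLS2BetaChartContChain
import Summits.QuantumFields.YangMills.Theorems.FluctuationComparisonRegPrIntLWregFibredChart
import Literature.Topology.ParametricInverseCompactFibre
import HarnessLib

/-!
# CHART∞ · II (LINE g18-1 `semiclassical_s2beta`, organ S2β, LAPLACE row): the per-bond inversion data of the (0.4)-chain are JOINTLY continuous on the guarded image graph

R3 = Balaban's UV-stability programme on the finite 3-torus, gauge group `SU(N)` (generic `(P, N)` here) — NOT d = 4, NOT infinite volume, NOT a mass gap,
NOT Clay; the Yang–Mills gap is NOT proved by anything in this file.  Helper toward crux `stmt-QuantumFields-20520` (`FluctuationComparisonRegPrIntL`),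
LINE g18-1, LAPLACE row, letter CHART∞.

* ★`isClosed_loopSmallSet`, ★★`isClosed_chainWindowGraph` — the small-history set and the guarded window graph
  `G_n(c) = {(U, g) | every loop variable of Ū⁽ᵏ⁾(U), k < n, is ≤ α ∧ g ∈ chainWindow α n U c}` are CLOSED (the `≤ α` conditions pass to the closure because the
  functions they constrain are continuous there, level by level: ✓`continuousAt_chainStepArg₂`); ★★`continuousOn_chainMap₂` (set edition of Part I §1).
* ★★★`exists_chainCharts_cont` = ✓`exists_chainCharts_lb` (F2 `…WregFibredChart`) re-run on Part I's ✓`chain_forwardLaw_contOn`, with two more conjuncts: the inverse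
chart `(U, v) ↦ ϑ c U v` and the inverse density `(U, v) ↦ jd c U v` are continuous on the guarded image graph
`{(U, v) | every loop variable of Ū⁽ᵏ⁾(U), k < n, is ≤ α ∧ v ∈ T c U}`.  The inverse is
`Literature.Topology.ParametricInverse.continuousOn_parametricInverse_of_compactSpace` (closed guarded window graph ✓`isClosed_chainWindowGraph`, jointly
continuous chain map ✓`continuousOn_chainMap₂`, compact `SU(N)`, Hausdorff values); the density is `(J c U (ϑ c U v))⁻¹` with `J` jointly continuous.
This is the chain-level content of «the fibre amplitude `a_V(z) = Jac(V, z)` of the height density is continuous in the fibre variable `z` on the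
small-history set» (the fibred chart of ✓`exists_fibredChart_iter_reg` is assembled from exactly these `T, ϑ, jd`).
-/

noncomputable section

open MeasureTheory Filter Topology Set Function
open scoped ENNReal NNReal
open Literature.MathematicalPhysics.QuantumFieldTheory.Balaban1983to89
open Literature.MathematicalPhysics.QuantumFieldTheory.Balaban1983to89.T4Continuum
open Literature.MathematicalPhysics.QuantumFieldTheory.Balaban1983to89.BlockAveraging (Idx avgFun measurable_avgFun loopHol)
open Literature.MathematicalPhysics.QuantumFieldTheory.Balaban1983to89.BlockAveragingHaarAC (centralBond pre post)
open Literature.MathematicalPhysics.QuantumFieldTheory.Balaban1983to89.BlockAveragingEMLHaarAC (fibreFamily offCard)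
open Literature.MathematicalPhysics.QuantumFieldTheory.Balaban1983to89.ExpMeanLog (expMeanLogSU deltaSU deltaSU_pos measurable_expMeanLogSU_E)
open Literature.MathematicalPhysics.QuantumFieldTheory.Balaban1983to89.Node00 (SU)
open Summit.QuantumFields.YangMills.Theorems.FluctuationComparisonRegPrIntLWregChain
open Summit.QuantumFields.YangMills.Theorems.FluctuationComparisonRegPrIntLWregFibredChart (measurableSet_chainWindow₂)
open Summit.QuantumFields.YangMills.Theorems.FluctuationComparisonRegPrIntLWregChartChargeOneStep (continuous_fibreFamily₂)
open Summit.QuantumFields.YangMills.Theorems.FluctuationComparisonRegPrIntLWregChartCharge (continuousAt_iter_of_loopSmall)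
open Summit.QuantumFields.YangMills.Theorems.FluctuationComparisonRegPrIntLS2BetaChartContChain

namespace Summit.QuantumFields.YangMills.Theorems.FluctuationComparisonRegPrIntLS2BetaChartContChainCharts

variable {P : Params} {N : ℕ} [NeZero N]

/-- ★ **THE SMALL-HISTORY SET IS CLOSED**: `{U | ∀ k < n, every loop variable of Ū⁽ᵏ⁾(U) is ≤ α}` is closed for `α < δ_N` — induction: on the closure of the
level-`(n+1)` set the level-`n` set holds (it is closed), so `Ū⁽ⁿ⁾` is continuous there (✓`continuousAt_iter_of_loopSmall`) and the closed condition
`dist1 (loopHol (Ū⁽ⁿ⁾ U) c' i) ≤ α` passes to the closure. [cite: Balaban1987RG1, (0.4) p.253 (bookkeeping)] -/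
theorem isClosed_loopSmallSet {α : ℝ} (hαδ : α < deltaSU (Fin N)) : ∀ n : ℕ,
    IsClosed {U : GaugeField P 0 (SU N) | ∀ k, k < n → ∀ (c' : PBond P (k + 1)) (i : Idx P),
      dist1 (loopHol (Averaging.iter (fun i => BlockAveraging.blockAvg (P := P) (j := i) (expMeanLogSU (n := Fin N))) k U) c' i) ≤ α}
  | 0 => by
      have h : {U : GaugeField P 0 (SU N) | ∀ k, k < 0 → ∀ (c' : PBond P (k + 1)) (i : Idx P),
          dist1 (loopHol (Averaging.iter (fun i => BlockAveraging.blockAvg (P := P) (j := i) (expMeanLogSU (n := Fin N))) k U) c' i) ≤ α} = univ :=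
        eq_univ_of_forall fun U k hk => absurd hk (Nat.not_lt_zero k)
      rw [h]; exact isClosed_univ
  | n + 1 => by
      have IH := isClosed_loopSmallSet hαδ n
      refine isClosed_of_closure_subset fun U₀ hU₀ => ?_
      have hsub : {U : GaugeField P 0 (SU N) | ∀ k, k < n + 1 → ∀ (c' : PBond P (k + 1)) (i : Idx P),
            dist1 (loopHol (Averaging.iter (fun i => BlockAveraging.blockAvg (P := P) (j := i) (expMeanLogSU (n := Fin N))) k U) c' i) ≤ α} ⊆
          {U : GaugeField P 0 (SU N) | ∀ k, k < n → ∀ (c' : PBond P (k + 1)) (i : Idx P),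
            dist1 (loopHol (Averaging.iter (fun i => BlockAveraging.blockAvg (P := P) (j := i) (expMeanLogSU (n := Fin N))) k U) c' i) ≤ α} :=
        fun U hU k hk => hU k (by omega)
      have hU₀n := IH.closure_subset_iff.2 hsub hU₀
      intro k hk c' i
      rcases Nat.lt_succ_iff_lt_or_eq.1 hk with hkn | rfl
      · exact hU₀n k hkn c' i
      · have hA := continuousAt_iter_of_loopSmall (P := P) (N := N) hαδ (n := k) U₀ hU₀n
        have hf : ContinuousAt (fun U : GaugeField P 0 (SU N) =>
            dist1 (loopHol (Averaging.iter (fun i => BlockAveraging.blockAvg (P := P) (j := i) (expMeanLogSU (n := Fin N))) k U) c' i)) U₀ :=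
          ((B12ContinuousTransportInvarianceOn.continuous_dist1_SU (N := N)).comp
            ((continuous_apply i).comp (BlockAveraging.continuous_loopHol (n := Fin N) c'))).continuousAt.comp hA
        have hmem := hf.continuousWithinAt.mem_closure_image hU₀
        have himg : (fun U : GaugeField P 0 (SU N) =>
            dist1 (loopHol (Averaging.iter (fun i => BlockAveraging.blockAvg (P := P) (j := i) (expMeanLogSU (n := Fin N))) k U) c' i)) ''
            {U : GaugeField P 0 (SU N) | ∀ k', k' < k + 1 → ∀ (c' : PBond P (k' + 1)) (i : Idx P),
              dist1 (loopHol (Averaging.iter (fun i => BlockAveraging.blockAvg (P := P) (j := i) (expMeanLogSU (n := Fin N))) k' U) c' i) ≤ α} ⊆ Iic α :=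
          image_subset_iff.2 fun U hU => hU k (lt_add_one k) c' i
        have h := closure_mono himg hmem
        rw [closure_Iic] at h
        exact h

/-- The argument `(U, g) ↦ (Ū⁽ⁿ⁾ U, pre · chainMap 𝓔 n U (centralBond c) g · post)` of the level-`(n+1)` one-step map is continuous at every guarded point
(✓`continuousAt_iter_of_loopSmall`, ✓`continuousAt_chainMap₂`, continuity of `pre`/`post`). [cite: Balaban1987RG1, (0.4) p.253 (bookkeeping)] -/
theorem continuousAt_chainStepArg₂ {α : ℝ} (hαδ : α < deltaSU (Fin N)) {n : ℕ} (hn : n ≤ P.m + P.K) (c : PBond P (n + 1))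
    (U₀ : GaugeField P 0 (SU N)) (g₀ : SU N)
    (hsmall : ∀ k, k < n → ∀ (c' : PBond P (k + 1)) (i : Idx P),
      dist1 (loopHol (Averaging.iter (fun i => BlockAveraging.blockAvg (P := P) (j := i) (expMeanLogSU (n := Fin N))) k U₀) c' i) ≤ α)
    (hg₀ : g₀ ∈ chainWindow (N := N) α n U₀ (centralBond c)) :
    ContinuousAt (fun p : GaugeField P 0 (SU N) × SU N =>
      ((Averaging.iter (fun i => BlockAveraging.blockAvg (P := P) (j := i) (expMeanLogSU (n := Fin N))) n p.1,
        pre (Averaging.iter (fun i => BlockAveraging.blockAvg (P := P) (j := i) (expMeanLogSU (n := Fin N))) n p.1) c *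
          chainMap (expMeanLogSU (n := Fin N)) n p.1 (centralBond c) p.2 *
          post (Averaging.iter (fun i => BlockAveraging.blockAvg (P := P) (j := i) (expMeanLogSU (n := Fin N))) n p.1) c) :
        GaugeField P n (SU N) × SU N)) (U₀, g₀) := by
  have IH := continuousAt_chainMap₂ (P := P) (N := N) hαδ (n := n) hn (centralBond c) U₀ g₀ hsmall hg₀
  have hA : ContinuousAt (Averaging.iter (fun i => BlockAveraging.blockAvg (P := P) (j := i) (expMeanLogSU (n := Fin N))) n) U₀ :=
    continuousAt_iter_of_loopSmall (N := N) hαδ U₀ hsmall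
  have henv : ContinuousAt (fun p : GaugeField P 0 (SU N) × SU N =>
      Averaging.iter (fun i => BlockAveraging.blockAvg (P := P) (j := i) (expMeanLogSU (n := Fin N))) n p.1) (U₀, g₀) :=
    hA.comp_of_eq continuousAt_fst rfl
  have hpre : ContinuousAt (fun p : GaugeField P 0 (SU N) × SU N =>
      pre (Averaging.iter (fun i => BlockAveraging.blockAvg (P := P) (j := i) (expMeanLogSU (n := Fin N))) n p.1) c) (U₀, g₀) :=
    (BlockAveraging.continuous_holAt _).continuousAt.comp_of_eq henv rfl
  have hpost : ContinuousAt (fun p : GaugeField P 0 (SU N) × SU N =>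
      post (Averaging.iter (fun i => BlockAveraging.blockAvg (P := P) (j := i) (expMeanLogSU (n := Fin N))) n p.1) c) (U₀, g₀) :=
    (BlockAveraging.continuous_holAt _).continuousAt.comp_of_eq henv rfl
  exact henv.prodMk ((hpre.mul IH).mul hpost)

/-- ★★ **THE GUARDED WINDOW GRAPH IS CLOSED**: for `n ≤ m+K` and `α < δ_N`, `{(U, g) | U has small loop history below level n ∧ g ∈ chainWindow α n U c}` is a
closed subset of `GaugeField × SU(N)` — induction through ✓`chainWindow_succ`: on the closure the level-`n` data hold (closed by induction), so the
level-`(n+1)` window condition, a `≤ α` condition on a function continuous there (✓`continuousAt_chainStepArg₂`, ✓`continuous_fibreFamily₂`), passes to the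
closure.  (This is the `hW` input of `Literature.Topology.ParametricInverse.continuousOn_parametricInverse_of_compactSpace`.)
[cite: Balaban1987RG1, (0.4) p.253 and (2.9) p.266 (bookkeeping)] -/
theorem isClosed_chainWindowGraph {α : ℝ} (hαδ : α < deltaSU (Fin N)) :
    ∀ {n : ℕ}, n ≤ P.m + P.K → ∀ c : PBond P n,
      IsClosed {p : GaugeField P 0 (SU N) × SU N |
        (∀ k, k < n → ∀ (c' : PBond P (k + 1)) (i : Idx P),
          dist1 (loopHol (Averaging.iter (fun i => BlockAveraging.blockAvg (P := P) (j := i) (expMeanLogSU (n := Fin N))) k p.1) c' i) ≤ α) ∧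
        p.2 ∈ chainWindow (N := N) α n p.1 c}
  | 0, _, c => by
      have h : {p : GaugeField P 0 (SU N) × SU N |
          (∀ k, k < 0 → ∀ (c' : PBond P (k + 1)) (i : Idx P),
            dist1 (loopHol (Averaging.iter (fun i => BlockAveraging.blockAvg (P := P) (j := i) (expMeanLogSU (n := Fin N))) k p.1) c' i) ≤ α) ∧
          p.2 ∈ chainWindow (N := N) α 0 p.1 c} = univ :=
        eq_univ_of_forall fun p => ⟨fun k hk => absurd hk (Nat.not_lt_zero k), trivial⟩
      rw [h]; exact isClosed_univ
  | n + 1, hn, c => by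
      have IH := isClosed_chainWindowGraph hαδ (n := n) (by omega) (centralBond c)
      have hS := (isClosed_loopSmallSet (P := P) (N := N) hαδ (n + 1)).preimage
        (continuous_fst : Continuous (Prod.fst : GaugeField P 0 (SU N) × SU N → GaugeField P 0 (SU N)))
      refine isClosed_of_closure_subset fun p₀ hp₀ => ?_
      -- the level-`n` data and the small history hold at `p₀`
      have hsubn : {p : GaugeField P 0 (SU N) × SU N |
            (∀ k, k < n + 1 → ∀ (c' : PBond P (k + 1)) (i : Idx P),
              dist1 (loopHol (Averaging.iter (fun i => BlockAveraging.blockAvg (P := P) (j := i) (expMeanLogSU (n := Fin N))) k p.1) c' i) ≤ α) ∧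
            p.2 ∈ chainWindow (N := N) α (n + 1) p.1 c} ⊆
          {p : GaugeField P 0 (SU N) × SU N |
            (∀ k, k < n → ∀ (c' : PBond P (k + 1)) (i : Idx P),
              dist1 (loopHol (Averaging.iter (fun i => BlockAveraging.blockAvg (P := P) (j := i) (expMeanLogSU (n := Fin N))) k p.1) c' i) ≤ α) ∧
            p.2 ∈ chainWindow (N := N) α n p.1 (centralBond c)} := fun p hp => by
        refine ⟨fun k hk => hp.1 k (by omega), ?_⟩
        have h2 := hp.2
        rw [chainWindow_succ] at h2
        exact h2.1
      have hp₀n := IH.closure_subset_iff.2 hsubn hp₀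
      have hp₀S := hS.closure_subset_iff.2 (fun p hp => hp.1) hp₀
      refine ⟨hp₀S, ?_⟩
      rw [chainWindow_succ]
      refine ⟨hp₀n.2, fun i => ?_⟩
      -- the level-`(n+1)` window condition passes to the closure
      have hf : ContinuousAt (fun p : GaugeField P 0 (SU N) × SU N =>
          dist1 (fibreFamily (Averaging.iter (fun i => BlockAveraging.blockAvg (P := P) (j := i) (expMeanLogSU (n := Fin N))) n p.1) c
            (pre (Averaging.iter (fun i => BlockAveraging.blockAvg (P := P) (j := i) (expMeanLogSU (n := Fin N))) n p.1) c *
              chainMap (expMeanLogSU (n := Fin N)) n p.1 (centralBond c) p.2 *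
              post (Averaging.iter (fun i => BlockAveraging.blockAvg (P := P) (j := i) (expMeanLogSU (n := Fin N))) n p.1) c) i)) p₀ := by
        have h := ((B12ContinuousTransportInvarianceOn.continuous_dist1_SU (N := N)).comp (continuous_fibreFamily₂ (N := N) c i)).continuousAt.comp
          (continuousAt_chainStepArg₂ (P := P) (N := N) hαδ (n := n) (by omega) c p₀.1 p₀.2 hp₀n.1 hp₀n.2)
        exact h
      have hmem := hf.continuousWithinAt.mem_closure_image hp₀
      have himg : (fun p : GaugeField P 0 (SU N) × SU N =>
          dist1 (fibreFamily (Averaging.iter (fun i => BlockAveraging.blockAvg (P := P) (j := i) (expMeanLogSU (n := Fin N))) n p.1) c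
            (pre (Averaging.iter (fun i => BlockAveraging.blockAvg (P := P) (j := i) (expMeanLogSU (n := Fin N))) n p.1) c *
              chainMap (expMeanLogSU (n := Fin N)) n p.1 (centralBond c) p.2 *
              post (Averaging.iter (fun i => BlockAveraging.blockAvg (P := P) (j := i) (expMeanLogSU (n := Fin N))) n p.1) c) i)) ''
          {p : GaugeField P 0 (SU N) × SU N |
            (∀ k, k < n + 1 → ∀ (c' : PBond P (k + 1)) (i : Idx P),
              dist1 (loopHol (Averaging.iter (fun i => BlockAveraging.blockAvg (P := P) (j := i) (expMeanLogSU (n := Fin N))) k p.1) c' i) ≤ α) ∧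
            p.2 ∈ chainWindow (N := N) α (n + 1) p.1 c} ⊆ Iic α :=
        image_subset_iff.2 fun p hp => by
          have h2 := hp.2
          rw [chainWindow_succ] at h2
          exact h2.2 i
      have h := closure_mono himg hmem
      rw [closure_Iic] at h
      exact h

/-- ★★ **THE CHAIN MAP IS JOINTLY CONTINUOUS ON THE GUARDED WINDOW GRAPH** (set edition of ✓`continuousAt_chainMap₂`; the `hF` input of
`Literature.Topology.ParametricInverse.continuousOn_parametricInverse_of_compactSpace`). [cite: Balaban1987RG1, (0.4) p.253] -/
theorem continuousOn_chainMap₂ {α : ℝ} (hαδ : α < deltaSU (Fin N)) {n : ℕ} (hn : n ≤ P.m + P.K) (c : PBond P n) :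
    ContinuousOn (fun p : GaugeField P 0 (SU N) × SU N => chainMap (expMeanLogSU (n := Fin N)) n p.1 c p.2)
      {p : GaugeField P 0 (SU N) × SU N |
        (∀ k, k < n → ∀ (c' : PBond P (k + 1)) (i : Idx P),
          dist1 (loopHol (Averaging.iter (fun i => BlockAveraging.blockAvg (P := P) (j := i) (expMeanLogSU (n := Fin N))) k p.1) c' i) ≤ α) ∧
        p.2 ∈ chainWindow (N := N) α n p.1 c} :=
  fun p hp => (continuousAt_chainMap₂ hαδ hn c p.1 p.2 hp.1 hp.2).continuousWithinAt

/-- ★★★ **PER-BOND INVERSION DATA OF THE CHAIN, JOINTLY CONTINUOUS IN (ENVIRONMENT, VALUE) ON THE GUARDED IMAGE GRAPH** — ✓`exists_chainCharts_lb` (F2) re-run on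
✓`chain_forwardLaw_contOn`, with two more conjuncts: the inverse chart `(U, v) ↦ ϑ c U v` and the inverse density `(U, v) ↦ jd c U v` are continuous on
`{(U, v) | U has small loop history below level n ∧ v ∈ T c U}`.  The inverse is `Literature.Topology.ParametricInverse.continuousOn_parametricInverse_of_compactSpace`
(parametrised inverses on compact fibres are jointly continuous: closed guarded window graph ✓`isClosed_chainWindowGraph`, jointly continuous chain map
✓`continuousOn_chainMap₂`, compact `SU(N)`, Hausdorff values); the density is `(J c U (ϑ c U v))⁻¹` with `J` jointly continuous (✓`chain_forwardLaw_contOn`).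
[cite: Balaban1987RG1, (0.4) p.253 and (2.10) p.267; BourbakiGT1, Ch. I §10 no. 2, Thm 1 Cor. 5; Kechris1995, Thm 15.1 and Cor 15.2] -/
theorem exists_chainCharts_cont {α : ℝ} (hα0 : 0 ≤ α) (hα24 : α ≤ 1 / 24) (hα64 : 64 * α ≤ deltaSU (Fin N))
    (hαL : 157 * α < ((P.L : ℝ) ^ (P.d - 1))⁻¹)
    (hgap : ∀ j (c : PBond P (j + 1)), (offCard c : ℝ) / (Fintype.card (Idx P) : ℝ) + 150 * α < 1)
    {j₀ : ℝ≥0} (hvol : j₀ = 0 ∨ ChainVol P N α j₀) {n : ℕ} (hn : n ≤ P.m + P.K) :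
    ∃ (T : PBond P n → GaugeField P 0 (SU N) → Set (SU N)) (ϑ : PBond P n → GaugeField P 0 (SU N) → SU N → SU N)
      (jd : PBond P n → GaugeField P 0 (SU N) → SU N → ℝ≥0),
      (∀ c, MeasurableSet {p : GaugeField P 0 (SU N) × SU N | p.2 ∈ T c p.1}) ∧
      (∀ c, Measurable fun p : GaugeField P 0 (SU N) × SU N => ϑ c p.1 p.2) ∧
      (∀ c, Measurable fun p : GaugeField P 0 (SU N) × SU N => jd c p.1 p.2) ∧
      (∀ c U, ∀ v ∈ T c U, chainMap (expMeanLogSU (n := Fin N)) n U c (ϑ c U v) = v) ∧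
      (∀ c U, (HaarData.haar : Measure (SU N)).restrict (chainWindow α n U c) =
        (((HaarData.haar : Measure (SU N)).restrict (T c U)).withDensity fun v => (jd c U v : ℝ≥0∞)).map (ϑ c U)) ∧
      (∀ c U, T c U = chainMap (expMeanLogSU (n := Fin N)) n U c '' chainWindow α n U c) ∧
      (∀ c U, ∀ g ∈ chainWindow α n U c, ϑ c U (chainMap (expMeanLogSU (n := Fin N)) n U c g) = g) ∧
      (∀ c U, ∀ v ∈ T c U, ϑ c U v ∈ chainWindow α n U c) ∧
      (∀ c U, IsClosed (T c U)) ∧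
      (∀ c U, ContinuousOn (ϑ c U) (T c U)) ∧
      (∀ c U, ContinuousOn (jd c U) (T c U)) ∧
      (∀ c U, ∀ v ∈ T c U, jd c U v ≠ 0) ∧
      (∀ c U, ∀ v ∈ T c U, j₀ ^ n * jd c U v ≤ 1) ∧
      (∀ c, ContinuousOn (fun p : GaugeField P 0 (SU N) × SU N => ϑ c p.1 p.2)
        {p : GaugeField P 0 (SU N) × SU N |
          (∀ k, k < n → ∀ (c' : PBond P (k + 1)) (i : Idx P),
            dist1 (loopHol (Averaging.iter (fun i => BlockAveraging.blockAvg (P := P) (j := i) (expMeanLogSU (n := Fin N))) k p.1) c' i) ≤ α) ∧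
          p.2 ∈ T c p.1}) ∧
      (∀ c, ContinuousOn (fun p : GaugeField P 0 (SU N) × SU N => jd c p.1 p.2)
        {p : GaugeField P 0 (SU N) × SU N |
          (∀ k, k < n → ∀ (c' : PBond P (k + 1)) (i : Idx P),
            dist1 (loopHol (Averaging.iter (fun i => BlockAveraging.blockAvg (P := P) (j := i) (expMeanLogSU (n := Fin N))) k p.1) c' i) ≤ α) ∧
          p.2 ∈ T c p.1}) := by
  have hαδ : α < deltaSU (Fin N) := by nlinarith [deltaSU_pos (n := Fin N)]
  have hinj : ∀ (c : PBond P n) (U : GaugeField P 0 (SU N)),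
      InjOn (fun g => chainMap (expMeanLogSU (n := Fin N)) n U c g) (chainWindow α n U c) :=
    fun c U => chainMap_injOn hα0 hα24 hαδ hgap hn U c
  have key : ∀ c : PBond P n, ∃ θ : GaugeField P 0 (SU N) × SU N → SU N, Measurable θ ∧
      (∀ U, ∀ g ∈ chainWindow α n U c, θ (U, chainMap (expMeanLogSU (n := Fin N)) n U c g) = g) ∧
      (∀ U, ∀ v ∈ (fun g => chainMap (expMeanLogSU (n := Fin N)) n U c g) '' chainWindow α n U c,
        chainMap (expMeanLogSU (n := Fin N)) n U c (θ (U, v)) = v ∧ θ (U, v) ∈ chainWindow α n U c) := fun c =>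
    (Literature.MeasureTheory.Function.exists_measurable_fibrewiseInverse
      (Ψ := fun p : GaugeField P 0 (SU N) × SU N => chainMap (expMeanLogSU (n := Fin N)) n p.1 c p.2)
      (Ω := fun U => chainWindow α n U c) (measurable_chainMap₂ n c) (measurableSet_chainWindow₂ α n c) (hinj c)).2
  have keyT : ∀ c : PBond P n, MeasurableSet {p : GaugeField P 0 (SU N) × SU N |
      p.2 ∈ (fun g => chainMap (expMeanLogSU (n := Fin N)) n p.1 c g) '' chainWindow α n p.1 c} := fun c =>
    (Literature.MeasureTheory.Function.exists_measurable_fibrewiseInverse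
      (Ψ := fun p : GaugeField P 0 (SU N) × SU N => chainMap (expMeanLogSU (n := Fin N)) n p.1 c p.2)
      (Ω := fun U => chainWindow α n U c) (measurable_chainMap₂ n c) (measurableSet_chainWindow₂ α n c) (hinj c)).1
  choose θ hθm hleft hright using key
  have hJ := fun c => chain_forwardLaw_contOn (N := N) (P := P) hα0 hα24 hα64 hαL hgap hvol n hn c
  choose J hJm hJ0 hJlaw hJc hJlb hJg using hJ
  have hθc : ∀ (c : PBond P n) (U : GaugeField P 0 (SU N)),
      ContinuousOn (fun v => θ c (U, v)) ((fun g => chainMap (expMeanLogSU (n := Fin N)) n U c g) '' chainWindow α n U c) := fun c U =>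
    continuousOn_leftInverse_image (isClosed_chainWindow hαδ hn U c) (continuousOn_chainMap hαδ hn U c) (hinj c U)
      (θ := fun v => θ c (U, v)) (fun v hv => (hright c U v hv).2) (fun v hv => (hright c U v hv).1)
  -- ★ joint continuity of the inverse on the guarded image graph (parametrised inverse on compact fibres)
  have hθg : ∀ c : PBond P n, ContinuousOn (fun p : GaugeField P 0 (SU N) × SU N => θ c (p.1, p.2))
      {p : GaugeField P 0 (SU N) × SU N |
        (∀ k, k < n → ∀ (c' : PBond P (k + 1)) (i : Idx P),
          dist1 (loopHol (Averaging.iter (fun i => BlockAveraging.blockAvg (P := P) (j := i) (expMeanLogSU (n := Fin N))) k p.1) c' i) ≤ α) ∧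
        p.2 ∈ (fun g => chainMap (expMeanLogSU (n := Fin N)) n p.1 c g) '' chainWindow α n p.1 c} := by
    intro c
    have h := Literature.Topology.ParametricInverse.continuousOn_parametricInverse_of_compactSpace
      (P := GaugeField P 0 (SU N)) (X := SU N) (Y := SU N)
      (F := fun U g => chainMap (expMeanLogSU (n := Fin N)) n U c g)
      (K := fun U => {g : SU N |
        (∀ k, k < n → ∀ (c' : PBond P (k + 1)) (i : Idx P),
          dist1 (loopHol (Averaging.iter (fun i => BlockAveraging.blockAvg (P := P) (j := i) (expMeanLogSU (n := Fin N))) k U) c' i) ≤ α) ∧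
        g ∈ chainWindow (N := N) α n U c})
      (ϑ := fun U v => θ c (U, v)) (isClosed_chainWindowGraph (P := P) (N := N) hαδ hn c) (continuousOn_chainMap₂ (P := P) (N := N) hαδ hn c)
      (fun U g hg => hleft c U g hg.2)
    refine h.mono fun p hp => ?_
    obtain ⟨g, hg, hgp⟩ := hp.2
    exact ⟨g, ⟨hp.1, hg⟩, hgp⟩
  refine ⟨fun c U => (fun g => chainMap (expMeanLogSU (n := Fin N)) n U c g) '' chainWindow α n U c, fun c U v => θ c (U, v),
    fun c U v => (J c U (θ c (U, v)))⁻¹, keyT, fun c => hθm c, fun c => ?_, fun c U v hv => (hright c U v hv).1, fun c U => ?_,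
    fun c U => rfl, fun c U g hg => hleft c U g hg, fun c U v hv => (hright c U v hv).2,
    fun c U => isClosed_image_chainWindow hαδ hn U c, hθc, fun c U => ?_, fun c U v hv => inv_ne_zero (hJ0 c U _ (hright c U v hv).2),
    fun c U v hv => ?lb, hθg, fun c => ?jdg⟩
  case lb =>
    have hx : J c U (θ c (U, v)) ≠ 0 := hJ0 c U _ (hright c U v hv).2
    calc j₀ ^ n * (J c U (θ c (U, v)))⁻¹ ≤ J c U (θ c (U, v)) * (J c U (θ c (U, v)))⁻¹ := mul_le_mul' (hJlb c U _) le_rfl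
      _ = 1 := mul_inv_cancel₀ hx
  case jdg =>
    have hcomp : ContinuousOn (fun p : GaugeField P 0 (SU N) × SU N => J c p.1 (θ c (p.1, p.2)))
        {p : GaugeField P 0 (SU N) × SU N |
          (∀ k, k < n → ∀ (c' : PBond P (k + 1)) (i : Idx P),
            dist1 (loopHol (Averaging.iter (fun i => BlockAveraging.blockAvg (P := P) (j := i) (expMeanLogSU (n := Fin N))) k p.1) c' i) ≤ α) ∧
          p.2 ∈ (fun g => chainMap (expMeanLogSU (n := Fin N)) n p.1 c g) '' chainWindow α n p.1 c} :=
      (hJg c).comp (continuousOn_fst.prodMk (hθg c)) fun p hp => ⟨hp.1, (hright c p.1 p.2 hp.2).2⟩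
    exact hcomp.inv₀ fun p hp => hJ0 c p.1 _ (hright c p.1 p.2 hp.2).2
  · exact ((hJm c).comp (measurable_fst.prodMk (hθm c))).inv
  rotate_left
  · exact ((hJc c U).comp (hθc c U) fun v hv => (hright c U v hv).2).inv₀ fun v hv => hJ0 c U _ (hright c U v hv).2
  · -- the inverse law from the forward law
    have hΩU : MeasurableSet (chainWindow α n U c) := measurableSet_chainWindow α n U c
    have hθU : Measurable fun v => θ c (U, v) := (hθm c).comp (measurable_const.prodMk measurable_id)
    have hjacU : Measurable fun g => (J c U g : ℝ≥0∞) :=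
      measurable_coe_nnreal_ennreal.comp ((hJm c).comp (measurable_const.prodMk measurable_id))
    have h := T4TriangularFibredChart.restrict_eq_map_withDensity_of_leftInvOn (ν := (HaarData.haar : Measure (SU N))) hΩU
      (measurable_chainMap n U c) hθU (hleft c U) hjacU (fun g hg => by exact_mod_cast hJ0 c U g hg) (fun g _ => ENNReal.coe_ne_top) (hJlaw c U)
    rw [h]
    congr 1
    refine withDensity_congr_ae ?_
    filter_upwards [ae_restrict_mem (keyT c |> fun h => (measurable_const.prodMk measurable_id) h)] with v hv
    rw [ENNReal.coe_inv (hJ0 c U _ ((hright c U v hv).2))]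

end Summit.QuantumFields.YangMills.Theorems.FluctuationComparisonRegPrIntLS2BetaChartContChainCharts

end
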